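import Literature.NumberTheory.LFunctions.WeilExplicit
import Literature.Analysis.Calculus.SmoothCutoff
import Mathlib.NumberTheory.LSeries.Dirichlet
import Mathlib.Analysis.Normed.Group.Tannery
import HarnessLib

/-!
# `WeilGroundState.GroundStatesConvergeToXi` — prime side of the explicit formula under plateau truncation
(crux item stmt-RiemannHypothesis-1527, route route-RiemannHypothesis-WeilGroundState; line `Sketch`,
stub `stub_primeTerm_truncation` (W12b); `--supports`)

Test functions of the EXPONENTIAL WEIL CLASS: `f : ℝ → ℂ` with `‖f(t)‖ ≤ C e^{-b₀|t|}`, `b₀ > 1/2`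
(smoothness and the derivative bounds of the class are not needed on the prime side).
Plateau truncation `f_R = f · χ_R` (`χ_R = Literature.Analysis.Calculus.cutoff R`: `= 1` on
`|t| ≤ R − 1`, `|χ_R| ≤ 1`).

* The prime series `Σ_n Λ(n) n^{-1/2} (f(log n) + f(-log n))` converges absolutely: for `n ≥ 1`,
  `Λ(n) n^{-1/2} (‖f(log n)‖ + ‖f(-log n)‖) ≤ 2C Λ(n) n^{-(1/2 + b₀)}` and `1/2 + b₀ > 1`
  (`ArithmeticFunction.LSeriesSummable_vonMangoldt`).
* `weilPrimeTerm f_R → weilPrimeTerm f` as `R → ∞`: Tannery's theorem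
  (`tendsto_tsum_of_dominated_convergence`) with the summable majorant
  `Λ(n) n^{-1/2} (‖f(log n)‖ + ‖f(-log n)‖)`; each term is eventually constant, since
  `χ_R(±log n) = 1` once `R ≥ log n + 1`.

No new definitions; no named fact is used.
-/

noncomputable section

set_option linter.dupNamespace false

open scoped Topology Real ArithmeticFunction.vonMangoldt
open Filter Set MeasureTheory Complex

namespace Summit.RiemannHypothesis.RiemannHypothesis.Theorems.GroundStatesConvergeToXi

open Literature.NumberTheory.LFunctions

/-- **Summable majorant of the prime side in the exponential class.** If
`‖f(t)‖ ≤ C e^{-b₀|t|}` with `b₀ > 1/2`, then `Σ_n ‖Λ(n)/√n‖ (‖f(log n)‖ + ‖f(-log n)‖) < ∞`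
(for `n ≥ 1` the term is at most `2C Λ(n) n^{-(1/2 + b₀)}`, and `Σ Λ(n) n^{-s} < ∞` for `s > 1`).
[folklore] -/
theorem ptTrunc_summable_majorant {f : ℝ → ℂ} {C b₀ : ℝ} (hb : 1 / 2 < b₀)
    (h0 : ∀ t, ‖f t‖ ≤ C * Real.exp (-(b₀ * |t|))) :
    Summable fun n : ℕ =>
      ‖((Λ n : ℝ) : ℂ) / (Real.sqrt n : ℂ)‖ * (‖f (Real.log n)‖ + ‖f (-Real.log n)‖) := by
  have hs : 1 < (((1 / 2 + b₀ : ℝ) : ℂ)).re := by rw [Complex.ofReal_re]; linarith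
  have hΛ : Summable fun n : ℕ =>
      ‖LSeries.term (fun n : ℕ => ((Λ n : ℝ) : ℂ)) ((1 / 2 + b₀ : ℝ) : ℂ) n‖ :=
    summable_norm_iff.mpr (ArithmeticFunction.LSeriesSummable_vonMangoldt hs)
  refine (hΛ.mul_left (2 * C)).of_nonneg_of_le (fun n => by positivity) (fun n => ?_)
  rcases Nat.eq_zero_or_pos n with rfl | hn
  · simp
  have hn' : (0 : ℝ) < n := Nat.cast_pos.mpr hn
  have hlog : 0 ≤ Real.log (n : ℝ) := Real.log_natCast_nonneg n
  rw [LSeries.norm_term_eq, if_neg hn.ne', Complex.ofReal_re, norm_div,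
    Complex.norm_of_nonneg ArithmeticFunction.vonMangoldt_nonneg,
    Complex.norm_of_nonneg (Real.sqrt_nonneg _)]
  have hexp : Real.exp (-(b₀ * |Real.log (n : ℝ)|)) = (n : ℝ) ^ (-b₀) := by
    rw [abs_of_nonneg hlog, Real.rpow_def_of_pos hn']
    congr 1
    ring
  have h1 : ‖f (Real.log n)‖ ≤ C * (n : ℝ) ^ (-b₀) := by
    have := h0 (Real.log n)
    rwa [hexp] at this
  have h2 : ‖f (-Real.log n)‖ ≤ C * (n : ℝ) ^ (-b₀) := by
    have := h0 (-Real.log n)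
    rwa [abs_neg, hexp] at this
  have hsqrt : Real.sqrt (n : ℝ) = (n : ℝ) ^ (1 / 2 : ℝ) := Real.sqrt_eq_rpow _
  have hsplit : (n : ℝ) ^ (1 / 2 + b₀ : ℝ) = (n : ℝ) ^ (1 / 2 : ℝ) * (n : ℝ) ^ b₀ :=
    Real.rpow_add hn' _ _
  have hneg : (n : ℝ) ^ (-b₀) = ((n : ℝ) ^ b₀)⁻¹ := Real.rpow_neg hn'.le _
  have hpos1 : 0 < (n : ℝ) ^ (1 / 2 : ℝ) := Real.rpow_pos_of_pos hn' _
  have hpos2 : 0 < (n : ℝ) ^ b₀ := Real.rpow_pos_of_pos hn' _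
  calc Λ n / Real.sqrt n * (‖f (Real.log n)‖ + ‖f (-Real.log n)‖)
      ≤ Λ n / Real.sqrt n * (C * (n : ℝ) ^ (-b₀) + C * (n : ℝ) ^ (-b₀)) :=
        mul_le_mul_of_nonneg_left (add_le_add h1 h2)
          (div_nonneg ArithmeticFunction.vonMangoldt_nonneg (Real.sqrt_nonneg _))
    _ = 2 * C * (Λ n / (n : ℝ) ^ (1 / 2 + b₀ : ℝ)) := by
        rw [hsqrt, hsplit, hneg]
        field_simp
        ring

/-- Termwise domination under truncation: with `|χ_R| ≤ 1`,
`‖Λ(n)/√n (f(log n) χ_R(log n) + f(-log n) χ_R(-log n))‖ ≤ ‖Λ(n)/√n‖ (‖f(log n)‖ + ‖f(-log n)‖)`.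
[folklore] -/
theorem ptTrunc_norm_term_le (f : ℝ → ℂ) (R : ℝ) (n : ℕ) :
    ‖((Λ n : ℝ) : ℂ) / (Real.sqrt n : ℂ) *
        (f (Real.log n) * ((Literature.Analysis.Calculus.cutoff R (Real.log n) : ℝ) : ℂ) +
          f (-Real.log n) * ((Literature.Analysis.Calculus.cutoff R (-Real.log n) : ℝ) : ℂ))‖ ≤
      ‖((Λ n : ℝ) : ℂ) / (Real.sqrt n : ℂ)‖ * (‖f (Real.log n)‖ + ‖f (-Real.log n)‖) := by
  rw [norm_mul]
  refine mul_le_mul_of_nonneg_left ((norm_add_le _ _).trans (add_le_add ?_ ?_)) (norm_nonneg _)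
  all_goals
    rw [norm_mul, Complex.norm_real, Real.norm_eq_abs]
    exact mul_le_of_le_one_right (norm_nonneg _)
      (Literature.Analysis.Calculus.abs_cutoff_le_one _ _)

/-- **Stub W12b — `primeTerm_truncation` (RH-free).**  For `f` in the exponential Weil class the
prime series `Σ_n Λ(n) n^{-1/2} (f(log n) + f(-log n))` converges absolutely
(`Λ(n) n^{-1/2} ‖f(±log n)‖ ≤ C Λ(n) n^{-1/2-b₀}`, `b₀ > 1/2`), and the prime terms of the
truncations converge: `weilPrimeTerm f_R → weilPrimeTerm f` (Tannery's dominated convergence for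
series, `|cutoff| ≤ 1`, `cutoff R (±log n) = 1` for `R ≥ log n + 1`).  The smoothness and
derivative hypotheses of the class are not used. [folklore] -/
theorem stub_primeTerm_truncation :
    ∀ (f : ℝ → ℂ) (C b₀ : ℝ), ContDiff ℝ (⊤ : ℕ∞) f → 1 / 2 < b₀ →
      (∀ t, ‖f t‖ ≤ C * Real.exp (-(b₀ * |t|))) →
      (∀ t, ‖deriv f t‖ ≤ C * Real.exp (-(b₀ * |t|))) →
      (∀ t, ‖deriv (deriv f) t‖ ≤ C * Real.exp (-(b₀ * |t|))) →
      Summable (fun n : ℕ =>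
          ‖((Λ n : ℝ) : ℂ) / (Real.sqrt n : ℂ) * (f (Real.log n) + f (-Real.log n))‖) ∧
      Tendsto (fun R : ℝ =>
          weilPrimeTerm (fun t : ℝ => f t * ((Literature.Analysis.Calculus.cutoff R t : ℝ) : ℂ)))
        atTop (𝓝 (weilPrimeTerm f)) := by
  intro f C b₀ _ hb h0 _ _
  have hmaj := ptTrunc_summable_majorant hb h0
  refine ⟨hmaj.of_nonneg_of_le (fun n => norm_nonneg _) (fun n => ?_), ?_⟩
  · rw [norm_mul]
    exact mul_le_mul_of_nonneg_left (norm_add_le _ _) (norm_nonneg _)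
  · unfold weilPrimeTerm
    refine tendsto_tsum_of_dominated_convergence hmaj (fun n => ?_)
      (Eventually.of_forall fun R n => ptTrunc_norm_term_le f R n)
    refine tendsto_const_nhds.congr' ?_
    filter_upwards [eventually_ge_atTop (Real.log n + 1)] with R hR
    have hlog : 0 ≤ Real.log (n : ℝ) := Real.log_natCast_nonneg n
    have h1 : Literature.Analysis.Calculus.cutoff R (Real.log n) = 1 :=
      Literature.Analysis.Calculus.cutoff_eq_one (by rw [abs_of_nonneg hlog]; linarith)
    have h2 : Literature.Analysis.Calculus.cutoff R (-Real.log n) = 1 :=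
      Literature.Analysis.Calculus.cutoff_eq_one (by rw [abs_neg, abs_of_nonneg hlog]; linarith)
    simp only [h1, h2, Complex.ofReal_one, mul_one]

end Summit.RiemannHypothesis.RiemannHypothesis.Theorems.GroundStatesConvergeToXi
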